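import Summits.Ventures.CertifiedManyBodySolver.Theorems.TcThermcert1FreeCanonicalFugacityTimeReversal
import Summits.Ventures.CertifiedManyBodySolver.Theorems.TcThermcert1FugacityProjection
import Literature.MathematicalPhysics.QuantumLattice.LatticeToriProofs
import HarnessLib

/-!
# Free canonical gas at `β·t = 8` — reduction of the rung: `ω_p(j) = 0` in every canonical sector, the covariance IS the insertion
expectation `ω_p(A j)`, and the sub-extensive ladder `R(s)` is (vacuously) settled for `s < 0`

Helper file for route `TcThermcert1` (crux K1′ `ThermalStiffnessCeilingU8b8_le_7o44`, item `stmt-Ventures-24560`), crux idea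
`free-canonical-b8-rung` (sketch `Cruxes/ThermalStiffnessCeilingU8b10_le_1o8/FreeCanonicalB8Sketch.lean`: targets `FreeCanonicalRungB8`,
`FreeCanonicalRungB8Sub s`). Three bookkeeping facts about the TARGET functional, in the sketch's unfolded vocabulary (same
unfolding convention as the tree's `freeGas_currentClusteringBody`):

* §1 **time reversal at the sector level**: for EVERY real `β` and EVERY `(N↑, N↓) = (M, N)` sector (presented by any predicate `p`),
  the compressed Gibbs state of the free flux-free torus gives the plain bond current zero expectation, `ω_p(j_{ab}) = 0`
  (tree: `trace_spinSectorProj_mul_gibbsWeight_mul_current_eq_zero` (S1, sector by sector) + the dictionary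
  `gibbsState_toBlock_eq_sectorTrace`);
* §2 hence the rung's covariance `ω_p(A j) − ω_p(A) ω_p(j)` IS the insertion expectation `ω_p(A j)` — the rung is a statement about
  one twisted trace with insertion, exactly the object of the two-leg pull-through identity and of S4/S6;
* §3 the sub-extensive ladder `R(s)` (`FreeCanonicalRungB8Sub s`, body unfolded) holds for every `s < 0` — VACUOUSLY: `|X| ≤ L^s < 1`
  forces `X = ∅`, an even observable on `orbSet ∅` is a scalar (`Algebra.adjoin ℂ ∅ = ⊥`; cf. the tree's
  `exists_eq_smul_one_of_mem_carEvenSubalgebra_empty`, not imported to keep the import closure inside the farm build), and the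
  covariance of a scalar with the current is `c · ω_p(j) = 0` by §1. This is the `s < 0` end of the ladder ONLY (plumbing witness: the
  body elaborates against tree imports and its trivial range is closed); the ranges `0 ≤ s ≤ 1` (crude insertion bound) and `1 < s < 2`
  (second-order insertion bound) and `R = R(2)` are NOT touched here — they need the insertion bound S6 and the contour assembly.

HONEST LABEL: statements about the FREE (`U = 0`) torus gas; a step of a RUNG (`U = 0`, BC5-type witness for the C8 bet), reach at `U = 8`
ZERO; decides nothing about K1/K1′/`T_c`; superconductivity in the Hubbard model is NOT proved or advanced by this file beyond the rung.
-/

noncomputable section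

namespace Summit.Ventures.CertifiedManyBodySolver.Theorems.TcThermcert1.FreeCanonicalB8

open Matrix Finset
open Literature.MathematicalPhysics.QuantumLattice
open Literature.Probability.LatticeModels (TorusSite)
open Summit.Ventures.CertifiedManyBodySolver.Theorems.TcThermcert1.FreeGasCurrentClustering
open Summit.Ventures.CertifiedManyBodySolver.Theorems.TcThermcert1.ZeroFreeCorridor (card_and_two_mul_card_filter_iff)
open scoped Matrix.Norms.L2Operator ComplexOrder

/-- An element of the even CAR algebra of the EMPTY orbital set has the entries of a scalar matrix: `A_{st} = c·[s = t]`
(generic orbital type; entrywise form, so that callers with another `DecidableEq` instance on the occupation basis are served). -/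
theorem scalar_of_mem_carEvenSubalgebra_empty {ι : Type*} [LinearOrder ι] [Fintype ι] {A : Matrix (Finset ι) (Finset ι) ℂ}
    (hA : A ∈ carEvenSubalgebra (∅ : Finset ι)) : ∃ c : ℂ, ∀ s t : Finset ι, A s t = if s = t then c else 0 := by
  have hgen : carEvenGenerators (∅ : Finset ι) = ∅ := by
    ext M
    simp only [carEvenGenerators, Finset.notMem_empty, false_and, exists_false, Set.mem_setOf_eq,
      Set.mem_empty_iff_false]
  have h : carEvenSubalgebra (∅ : Finset ι) = ⊥ := by
    rw [carEvenSubalgebra, hgen, Algebra.adjoin_empty]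
  rw [h, Algebra.mem_bot] at hA
  obtain ⟨c, rfl⟩ := hA
  refine ⟨c, fun s t => ?_⟩
  rw [Algebra.algebraMap_eq_smul_one, Matrix.smul_apply, Matrix.one_apply, smul_eq_mul]
  split_ifs <;> simp

variable (L : ℕ) [NeZero L]

/-! ## §1 `ω_p(j) = 0` in every canonical sector of the free flux-free torus -/

/-- **Time reversal, sector level.** For every real `β`, every `(M, N)` sector presented by `p` and every pair of sites `a, b`:
`gibbsState β (H₀)_p (j_{ab})_p = 0`, `H₀ = hubbardTorusTT'Flux L 0 0 0`, `j_{ab} = Σ_σ (−i c†_{aσ} c_{bσ} + i c†_{bσ} c_{aσ})`. -/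
theorem torus_sectorGibbs_current_eq_zero (β : ℝ) {M N : ℕ} (p : Finset (Orb (FermionTorus 2 L)) → Prop) [DecidablePred p]
    (hp : ∀ s, p s ↔ (upPart s).card = M ∧ (downPart s).card = N) (a b : FermionTorus 2 L) :
    gibbsState β ((hubbardTorusTT'Flux L 0 0 0).toBlock p p)
      ((∑ σ : Fin 2, ((-Complex.I) • (creation (orb a σ) * annihilation (orb b σ)) +
          Complex.I • (creation (orb b σ) * annihilation (orb a σ)))).toBlock p p) = 0 := by
  have hsym : ∀ q k : Orb (FermionTorus 2 L),
      hubbardOneBody (fermionTorusGraph 2 L) 1 0 q k = hubbardOneBody (fermionTorusGraph 2 L) 1 0 k q := fun q k => by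
    have h := congrFun (congrFun (hubbardOneBody_torus_transpose L) k) q
    rw [transpose_apply] at h
    exact h
  have hspin : ∀ q k : Orb (FermionTorus 2 L), (ofLex q).2 ≠ (ofLex k).2 →
      hubbardOneBody (fermionTorusGraph 2 L) 1 0 q k = 0 :=
    fun q k hqk => by rw [hubbardOneBody_torus_apply, if_neg (fun h => hqk h.2)]
  have hP := preservesSectors_dGamma_of_spinDiag (hubbardOneBody (fermionTorusGraph 2 L) 1 0) hspin
  have key := gibbsState_toBlock_eq_sectorTrace hP β p hp
    (∑ σ : Fin 2, ((-Complex.I) • (creation (orb a σ) * annihilation (orb b σ)) +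
      Complex.I • (creation (orb b σ) * annihilation (orb a σ))))
  rw [trace_spinSectorProj_mul_gibbsWeight_mul_current_eq_zero _ hsym hspin β M N a b, mul_zero] at key
  rw [hubbardTorusTT'Flux_free_eq_dGamma]
  convert key using 4

/-- **`ω_p(j_{X₀,y}) = 0` for the line's bond and the line's sector predicate** (`(N, N↑) = (2m, m)`, `m = ⌊(1−δ)L²/2⌋`, any `δ`, any `β`). -/
theorem torus_sectorGibbs_bondCurrent_eq_zero (β δ : ℝ) (X₀ y : ZMod L) :
    gibbsState β ((hubbardTorusTT'Flux L 0 0 0).toBlock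
        (fun s => s.card = 2 * ⌊(1 - δ) * (L : ℝ) ^ 2 / 2⌋₊ ∧
          2 * (s.filter fun i => (ofLex i).2 = 0).card = 2 * ⌊(1 - δ) * (L : ℝ) ^ 2 / 2⌋₊)
        (fun s => s.card = 2 * ⌊(1 - δ) * (L : ℝ) ^ 2 / 2⌋₊ ∧
          2 * (s.filter fun i => (ofLex i).2 = 0).card = 2 * ⌊(1 - δ) * (L : ℝ) ^ 2 / 2⌋₊))
      ((∑ σ : Fin 2,
        ((-Complex.I) • (creation (orb (FermionTorus.ofTorusSite (![X₀, y] : TorusSite 2 L)) σ) *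
            annihilation (orb (FermionTorus.ofTorusSite (![X₀ - 1, y] : TorusSite 2 L)) σ)) +
          Complex.I • (creation (orb (FermionTorus.ofTorusSite (![X₀ - 1, y] : TorusSite 2 L)) σ) *
            annihilation (orb (FermionTorus.ofTorusSite (![X₀, y] : TorusSite 2 L)) σ)))).toBlock
        (fun s => s.card = 2 * ⌊(1 - δ) * (L : ℝ) ^ 2 / 2⌋₊ ∧
          2 * (s.filter fun i => (ofLex i).2 = 0).card = 2 * ⌊(1 - δ) * (L : ℝ) ^ 2 / 2⌋₊)
        (fun s => s.card = 2 * ⌊(1 - δ) * (L : ℝ) ^ 2 / 2⌋₊ ∧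
          2 * (s.filter fun i => (ofLex i).2 = 0).card = 2 * ⌊(1 - δ) * (L : ℝ) ^ 2 / 2⌋₊)) = 0 :=
  torus_sectorGibbs_current_eq_zero L β _ (fun s => card_and_two_mul_card_filter_iff s _) _ _

/-! ## §2 The covariance is the insertion expectation -/

/-- **Reduction of the rung's functional.** In every `(M, N)` sector of the free flux-free torus and for every operator `A`:
`ω_p(A j_{ab}) − ω_p(A) ω_p(j_{ab}) = ω_p(A j_{ab})`. -/
theorem torus_sectorCov_current_eq_insertion (β : ℝ) {M N : ℕ} (p : Finset (Orb (FermionTorus 2 L)) → Prop) [DecidablePred p]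
    (hp : ∀ s, p s ↔ (upPart s).card = M ∧ (downPart s).card = N)
    (A : Matrix (Finset (Orb (FermionTorus 2 L))) (Finset (Orb (FermionTorus 2 L))) ℂ) (a b : FermionTorus 2 L) :
    gibbsState β ((hubbardTorusTT'Flux L 0 0 0).toBlock p p)
        ((A * (∑ σ : Fin 2, ((-Complex.I) • (creation (orb a σ) * annihilation (orb b σ)) +
          Complex.I • (creation (orb b σ) * annihilation (orb a σ))))).toBlock p p) -
      gibbsState β ((hubbardTorusTT'Flux L 0 0 0).toBlock p p) (A.toBlock p p) *
        gibbsState β ((hubbardTorusTT'Flux L 0 0 0).toBlock p p)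
          ((∑ σ : Fin 2, ((-Complex.I) • (creation (orb a σ) * annihilation (orb b σ)) +
            Complex.I • (creation (orb b σ) * annihilation (orb a σ)))).toBlock p p) =
    gibbsState β ((hubbardTorusTT'Flux L 0 0 0).toBlock p p)
        ((A * (∑ σ : Fin 2, ((-Complex.I) • (creation (orb a σ) * annihilation (orb b σ)) +
          Complex.I • (creation (orb b σ) * annihilation (orb a σ))))).toBlock p p) := by
  rw [torus_sectorGibbs_current_eq_zero L β p hp a b, mul_zero, sub_zero]

/-! ## §3 The vacuous end of the ladder: `R(s)` for `s < 0` -/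

/-- On a torus with `L ≥ 2` sites per side, a support with `|X| ≤ L^s`, `s < 0`, is empty. -/
theorem support_eq_empty_of_card_le_rpow_neg {L : ℕ} (hL : 2 ≤ L) {s : ℝ} (hs : s < 0) {X : Finset (FermionTorus 2 L)}
    (hX : (X.card : ℝ) ≤ (L : ℝ) ^ s) : X = ∅ := by
  have hL1 : (1 : ℝ) < L := by exact_mod_cast hL
  have h1 : (L : ℝ) ^ s < 1 := Real.rpow_lt_one_of_one_lt_of_neg hL1 hs
  have h2 : (X.card : ℝ) < 1 := lt_of_le_of_lt hX h1
  have h3 : X.card = 0 := by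
    have : X.card < 1 := by exact_mod_cast h2
    omega
  exact Finset.card_eq_zero.1 h3

/-- **`R(s)` for `s < 0` — the body of `FreeCanonicalRungB8Sub s` (sketch `FreeCanonicalB8Sketch.lean`, line-local definitions
`FockOp`, `sectorPred`, `SectorPreserving`, `sectorExpect`, `bondCurrent` unfolded; instantiate by `unfold …; exact`) holds VACUOUSLY:**
with `ξ = 1`, `C = 0`, `k = 0`, `L₀ = 2`, a support `|X| ≤ L^s < 1` is empty, the even observable is a scalar `c·1`, and
`ω_p(c·j) − ω_p(c·1) ω_p(j) = c·ω_p(j) − … = 0` by time reversal (§1). Plumbing witness for the ladder; NO analytic content; the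
ranges `0 ≤ s < 2` and the rung `R` itself remain OPEN. -/
theorem freeCanonical_rungSubBody_of_neg {s : ℝ} (hs : s < 0) :
    ∃ ξ : ℝ, 0 < ξ ∧ ∃ C : ℝ, ∃ k L₀ : ℕ, ∀ (L : ℕ) [NeZero L], L₀ ≤ L →
      ∀ (X : Finset (FermionTorus 2 L)) (A : Matrix (Finset (Orb (FermionTorus 2 L))) (Finset (Orb (FermionTorus 2 L))) ℂ),
        (X.card : ℝ) ≤ (L : ℝ) ^ s →
        A ∈ carEvenSubalgebra (orbSet X) →
        (∀ s t : Finset (Orb (FermionTorus 2 L)),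
          (s.card = 2 * ⌊(1 - (1 - 7 / 8)) * (L : ℝ) ^ 2 / 2⌋₊ ∧
            2 * (s.filter fun i => (ofLex i).2 = 0).card = 2 * ⌊(1 - (1 - 7 / 8)) * (L : ℝ) ^ 2 / 2⌋₊) →
          ¬ (t.card = 2 * ⌊(1 - (1 - 7 / 8)) * (L : ℝ) ^ 2 / 2⌋₊ ∧
            2 * (t.filter fun i => (ofLex i).2 = 0).card = 2 * ⌊(1 - (1 - 7 / 8)) * (L : ℝ) ^ 2 / 2⌋₊) →
          A s t = 0 ∧ A t s = 0) →
        ∀ (X₀ y : ZMod L) (d : ℕ),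
          (∀ x ∈ X, d ≤ torusDist x.toTorusSite ![X₀, y] ∧ d ≤ torusDist x.toTorusSite ![X₀ - 1, y]) →
          ‖gibbsState 8 ((hubbardTorusTT'Flux L 0 0 0).toBlock
                (fun s => s.card = 2 * ⌊(1 - (1 - 7 / 8)) * (L : ℝ) ^ 2 / 2⌋₊ ∧
                  2 * (s.filter fun i => (ofLex i).2 = 0).card = 2 * ⌊(1 - (1 - 7 / 8)) * (L : ℝ) ^ 2 / 2⌋₊)
                (fun s => s.card = 2 * ⌊(1 - (1 - 7 / 8)) * (L : ℝ) ^ 2 / 2⌋₊ ∧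
                  2 * (s.filter fun i => (ofLex i).2 = 0).card = 2 * ⌊(1 - (1 - 7 / 8)) * (L : ℝ) ^ 2 / 2⌋₊))
              ((A * (∑ σ : Fin 2,
                ((-Complex.I) • (creation (orb (FermionTorus.ofTorusSite (![X₀, y] : TorusSite 2 L)) σ) *
                    annihilation (orb (FermionTorus.ofTorusSite (![X₀ - 1, y] : TorusSite 2 L)) σ)) +
                  Complex.I • (creation (orb (FermionTorus.ofTorusSite (![X₀ - 1, y] : TorusSite 2 L)) σ) *
                    annihilation (orb (FermionTorus.ofTorusSite (![X₀, y] : TorusSite 2 L)) σ))))).toBlock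
                (fun s => s.card = 2 * ⌊(1 - (1 - 7 / 8)) * (L : ℝ) ^ 2 / 2⌋₊ ∧
                  2 * (s.filter fun i => (ofLex i).2 = 0).card = 2 * ⌊(1 - (1 - 7 / 8)) * (L : ℝ) ^ 2 / 2⌋₊)
                (fun s => s.card = 2 * ⌊(1 - (1 - 7 / 8)) * (L : ℝ) ^ 2 / 2⌋₊ ∧
                  2 * (s.filter fun i => (ofLex i).2 = 0).card = 2 * ⌊(1 - (1 - 7 / 8)) * (L : ℝ) ^ 2 / 2⌋₊))
            - gibbsState 8 ((hubbardTorusTT'Flux L 0 0 0).toBlock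
                (fun s => s.card = 2 * ⌊(1 - (1 - 7 / 8)) * (L : ℝ) ^ 2 / 2⌋₊ ∧
                  2 * (s.filter fun i => (ofLex i).2 = 0).card = 2 * ⌊(1 - (1 - 7 / 8)) * (L : ℝ) ^ 2 / 2⌋₊)
                (fun s => s.card = 2 * ⌊(1 - (1 - 7 / 8)) * (L : ℝ) ^ 2 / 2⌋₊ ∧
                  2 * (s.filter fun i => (ofLex i).2 = 0).card = 2 * ⌊(1 - (1 - 7 / 8)) * (L : ℝ) ^ 2 / 2⌋₊))
              (A.toBlock
                (fun s => s.card = 2 * ⌊(1 - (1 - 7 / 8)) * (L : ℝ) ^ 2 / 2⌋₊ ∧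
                  2 * (s.filter fun i => (ofLex i).2 = 0).card = 2 * ⌊(1 - (1 - 7 / 8)) * (L : ℝ) ^ 2 / 2⌋₊)
                (fun s => s.card = 2 * ⌊(1 - (1 - 7 / 8)) * (L : ℝ) ^ 2 / 2⌋₊ ∧
                  2 * (s.filter fun i => (ofLex i).2 = 0).card = 2 * ⌊(1 - (1 - 7 / 8)) * (L : ℝ) ^ 2 / 2⌋₊))
              * gibbsState 8 ((hubbardTorusTT'Flux L 0 0 0).toBlock
                (fun s => s.card = 2 * ⌊(1 - (1 - 7 / 8)) * (L : ℝ) ^ 2 / 2⌋₊ ∧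
                  2 * (s.filter fun i => (ofLex i).2 = 0).card = 2 * ⌊(1 - (1 - 7 / 8)) * (L : ℝ) ^ 2 / 2⌋₊)
                (fun s => s.card = 2 * ⌊(1 - (1 - 7 / 8)) * (L : ℝ) ^ 2 / 2⌋₊ ∧
                  2 * (s.filter fun i => (ofLex i).2 = 0).card = 2 * ⌊(1 - (1 - 7 / 8)) * (L : ℝ) ^ 2 / 2⌋₊))
              ((∑ σ : Fin 2,
                ((-Complex.I) • (creation (orb (FermionTorus.ofTorusSite (![X₀, y] : TorusSite 2 L)) σ) *
                    annihilation (orb (FermionTorus.ofTorusSite (![X₀ - 1, y] : TorusSite 2 L)) σ)) +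
                  Complex.I • (creation (orb (FermionTorus.ofTorusSite (![X₀ - 1, y] : TorusSite 2 L)) σ) *
                    annihilation (orb (FermionTorus.ofTorusSite (![X₀, y] : TorusSite 2 L)) σ)))).toBlock
                (fun s => s.card = 2 * ⌊(1 - (1 - 7 / 8)) * (L : ℝ) ^ 2 / 2⌋₊ ∧
                  2 * (s.filter fun i => (ofLex i).2 = 0).card = 2 * ⌊(1 - (1 - 7 / 8)) * (L : ℝ) ^ 2 / 2⌋₊)
                (fun s => s.card = 2 * ⌊(1 - (1 - 7 / 8)) * (L : ℝ) ^ 2 / 2⌋₊ ∧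
                  2 * (s.filter fun i => (ofLex i).2 = 0).card = 2 * ⌊(1 - (1 - 7 / 8)) * (L : ℝ) ^ 2 / 2⌋₊))‖
            ≤ C * ‖A‖ * (X.card : ℝ) ^ k * Real.exp (-(d : ℝ) / ξ) := by
  refine ⟨1, one_pos, 0, 0, 2, fun L _ hL X A hX hA _ X₀ y d _ => ?_⟩
  have hXe : X = ∅ := support_eq_empty_of_card_le_rpow_neg hL hs hX
  -- an even observable on the empty support is a scalar: its entries are `c·[s = t]`
  have horb : orbSet (∅ : Finset (FermionTorus 2 L)) = ∅ := by
    ext k; simp [mem_orbSet]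
  rw [hXe, horb] at hA
  obtain ⟨c, hc⟩ := scalar_of_mem_carEvenSubalgebra_empty hA
  have hA1 : A = c • (1 : Matrix (Finset (Orb (FermionTorus 2 L))) (Finset (Orb (FermionTorus 2 L))) ℂ) := by
    ext s t
    rw [hc s t, Matrix.smul_apply, Matrix.one_apply, smul_eq_mul]
    split_ifs <;> simp
  have hj := torus_sectorGibbs_bondCurrent_eq_zero L 8 (1 - 7 / 8) X₀ y
  rw [hA1, Matrix.smul_mul, Matrix.one_mul]
  have hsm : ∀ (J : Matrix (Finset (Orb (FermionTorus 2 L))) (Finset (Orb (FermionTorus 2 L))) ℂ)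
      (q : Finset (Orb (FermionTorus 2 L)) → Prop), (c • J).toBlock q q = c • J.toBlock q q := fun J q => rfl
  rw [hsm, LinearMap.map_smul, hj, smul_zero, mul_zero, sub_zero, norm_zero, zero_mul, zero_mul, zero_mul]
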